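import Summits.BirchSwinnertonDyer.Rank1Residual.GaloisImage.NineTorsionScalarStabiliserSocket
import Summits.BirchSwinnertonDyer.Rank1Residual.GaloisImage.IntermediateRamificationSocket
import HarnessLib

/-!
# The SCALAR-STABILISER TOWER CRITERION at `9`: a `Stab(C)`-invariant element of `ℚ(E[9])` whose
# `3`-adic valuation has denominator divisible by `9` gives the whole `3`-adic tower from surj(3)
# (cell `b2b-bsdres`, team n1011, seat p02 gen 5 — row T-b11-F4, assembly of F4a
# `IntermediateRamificationSocket` (ramification half) and F4b `NineTorsionScalarStabiliserSocket`
# (group half); no reduction hypothesis, no named fact)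

HONEST FRAMING (cell `b2b-bsdres`, run/shared/lean/b2b/bsd-rank1-residual/, verbatim in every
file): the goal of the cell is to DELETE the COMBINATION-SHAPED residual classes of the
Birch–Swinnerton-Dyer formula for ALL analytic-rank `≤ 1` elliptic curves over `ℚ` — "full BSD
formula for every rank `≤ 1` curve in class `C`" assembled STRICTLY from published theorems — so
that the rank-`≤ 1` remainder becomes exactly the CONSTRUCTION-SHAPED classes, which are TYPED
(missing-input `Prop`s), NOT attempted. This is not "finishing BSD". Team n1011 (N10 / N11):
research route; no claim beyond the stated classes; labels UNCHANGED; nothing is booked. Theorems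
only (no definition, no named fact).

## What this file proves (M3-LOCAL-NOTE §8.1 as a kernel theorem)

Let `E = W/ℚ` with `ρ̄_{E,3}` onto, `C ⊆ E[9]` a set closed under the scalars `(1 + 3m)·` (e.g. a
cyclic subgroup `ℤ·Q₀` of order `9`), and `z ∈ ℚ(E[9])` a non-zero element FIXED BY THE SET-WISE
STABILISER `Stab(C) ≤ Γ_ℚ` (an "invariant of the pair `(E, C)`", e.g. a symmetric function of the
abscissae `x(Q₀), x(2Q₀), x(4Q₀)`).  If `v(z)^d · v(3)^a = v(3)^b` for the place `v` of `ℚ̄` over `3`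
with `d` coprime to `a − b` and `9 ∣ d` — the `3`-adic valuation of `z` has denominator divisible by
`9` — then `ρ̄_{E,3ⁿ}` is onto for every `n`:

* `nine_dvd_relIndex_stabilizer_inertia_of_valuation` — F4a gives `9 ∣ d ∣ [I_𝔓 : I_𝔓 ∩ Stab C]`
  for the prime `𝔓` of the place;
* **`towerSurj_three_of_surj_of_valuation_of_stabilizer`** — then F4b
  (`towerSurj_three_of_surj_of_nine_dvd_relIndex_stabilizer`: the `I_𝔓`-orbit of `C` has size
  divisible by `9`, impossible if `ρ̄₉(I_𝔓) ∩ (1 + 3M₂)` were scalar, so a non-scalar first-order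
  witness exists and Serre IV-23 applies); `imageContainsSL2_three_of_surj_of_valuation_of_stabilizer`
  (Kato (12.5.2));
* `towerSurj_three_of_surj_of_valuation_of_smul_zmultiples` — the CYCLIC form: `Q₀ ∈ E[9]` and `z`
  fixed by every `σ ∈ Γ_ℚ` with `σ Q₀ ∈ ℤ·Q₀`;
* `not_nine_dvd_of_valuation_of_not_towerSurj` — contrapositive: on an EXOTIC row (surj(3), tower
  fails) NO `Stab(C)`-invariant non-zero `z ∈ ℚ(E[9])` satisfies such an identity with `9 ∣ d`: every
  field `ℚ₃(C)` has ramification index prime to `9` — the sharp form of "type E".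

Compared with the gen-2 count socket (`27 ∣ d` for an arbitrary `z ∈ ℚ(E[9])`, p254468), the
stabiliser-invariance of `z` buys one factor `3`: `9 ∣ d` suffices.  This is the socket into which an
explicit `ℚ(C)`-valued invariant with `9`-denominator valuation on the families `v₃(j) ∈ {4, 5}` of
the EXOTIC core (row T-b11-F4, target F4c; numerically `ŝ₁(C) − c₆/3^{n₄}` at `v₃ j = 4`,
`ŝ₂(C) − 3^{n₄−2}` at `v₃ j = 5`, M3-LOCAL-NOTE §8.7) is to be plugged.  Nothing booked; no label
change.

References: [SerreLocalFields1979] Ch. I §7 Prop. 20–22; [SerreAbelianLadic1968] Ch. IV §3.4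
Lemma 3 (IV-23); [Elkies2006] arXiv:math/0612734 §1; [Kato2004Asterisque] (12.5.2) p. 222.
-/

noncomputable section

open scoped Classical NumberField Pointwise
open Field IsDedekindDomain WeierstrassCurve

namespace Summit.BirchSwinnertonDyer.Rank1Residual.GaloisImage

open Literature.NumberTheory.EllipticCurves Literature.NumberTheory.GaloisRepresentations
  Rat.HeightOneSpectrum

variable (W : WeierstrassCurve ℚ) [W.IsElliptic]

/-- **`9 ∣ [I_𝔓 : I_𝔓 ∩ Stab C]` from one invariant.**  With the place data `(v, 𝔓)` over `3`
explicit: if a non-zero `z ∈ ℚ(E[9])` is fixed by the set-wise stabiliser of `C ⊆ E(ℚ̄)` and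
`v(z)^d · v(3)^a = v(3)^b` with `d` coprime to `a − b` and `9 ∣ d`, then `9 ∣ [I_𝔓 : I_𝔓 ∩ Stab C]`
(F4a `dvd_relIndex_inertia_of_valuation_divisionField`).
[cite: SerreLocalFields1979, Ch. I §7 Cor. to Prop. 21 and Prop. 22] -/
theorem nine_dvd_relIndex_stabilizer_inertia_of_valuation
    {v : HeightOneSpectrum (𝓞 ℚ)} (hv : (primesEquiv v : ℕ) = 3)
    {𝔓 : Ideal (absIntegers (𝓞 ℚ) ℚ)}
    (hmem : ∀ x : absIntegers (𝓞 ℚ) ℚ, x ∈ 𝔓 ↔ (x : AlgebraicClosure ℚ) ∈ (placeOver 3).nonunits)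
    (h𝔓 : 𝔓 ∈ v.primesAbove) (C : Set W.geomPoints)
    {z : AlgebraicClosure ℚ} (hzL : z ∈ W.divisionField 9) (hz0 : z ≠ 0)
    (hfix : ∀ σ ∈ MulAction.stabilizer (absoluteGaloisGroup ℚ) C, σ • z = z) {d a b : ℕ}
    (hval : (placeOver 3).valuation z ^ d * (placeOver 3).valuation 3 ^ a =
      (placeOver 3).valuation 3 ^ b)
    (hcop : IsCoprime (d : ℤ) ((a : ℤ) - b)) (h9 : 9 ∣ d) :
    9 ∣ (MulAction.stabilizer (absoluteGaloisGroup ℚ) C).relIndex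
      (𝔓.inertia (absoluteGaloisGroup ℚ)) := by
  haveI : NeZero (9 : ℕ) := ⟨by norm_num⟩
  exact h9.trans (dvd_relIndex_inertia_of_valuation_divisionField (W := W) (n := 9) hv hmem h𝔓
    hzL hz0 _ hfix hval hcop)

/-- **SCALAR-STABILISER TOWER CRITERION.**  Let `ρ̄_{E,3}` be onto, `C ⊆ E[9]` closed under the
scalars `(1 + 3m)·`, and `z ∈ ℚ(E[9])` non-zero and fixed by every `σ ∈ Γ_ℚ` with `σ C = C`.  If
`v(z)^d · v(3)^a = v(3)^b` (`v` the place of `ℚ̄` over `3`) with `d` coprime to `a − b` and `9 ∣ d`,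
then `ρ̄_{E,3ⁿ}` is onto for every `n`: the `I_𝔓`-orbit of `C` has size divisible by `9`
(`nine_dvd_relIndex_stabilizer_inertia_of_valuation`), which forces a non-scalar element of
`ρ̄₉(I_𝔓) ∩ ker(→ GL₂(𝔽₃))` (F4b), and Serre's lemma IV-23 lifts (p252833).
[cite: SerreAbelianLadic1968, Ch. IV §3.4, Lemma 3 (IV-23)] [cite: SerreLocalFields1979, Ch. I §7 Prop. 22] -/
theorem towerSurj_three_of_surj_of_valuation_of_stabilizer
    (hsurj : W.HasSurjectiveModNGaloisRep 3)
    {C : Set W.geomPoints} (hC9 : C ⊆ (geomTorsion W 9 : Set W.geomPoints))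
    (hCsmul : ∀ m : ℕ, ∀ Q ∈ C, (1 + 3 * m) • Q ∈ C)
    {z : AlgebraicClosure ℚ} (hzL : z ∈ W.divisionField 9) (hz0 : z ≠ 0)
    (hfix : ∀ σ ∈ MulAction.stabilizer (absoluteGaloisGroup ℚ) C, σ • z = z) {d a b : ℕ}
    (hval : (placeOver 3).valuation z ^ d * (placeOver 3).valuation 3 ^ a =
      (placeOver 3).valuation 3 ^ b)
    (hcop : IsCoprime (d : ℤ) ((a : ℤ) - b)) (h9 : 9 ∣ d) (n : ℕ) :
    W.HasSurjectiveModNGaloisRep (3 ^ n : ℕ) := by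
  haveI : Fact (Nat.Prime 3) := ⟨Nat.prime_three⟩
  obtain ⟨v, hv⟩ : ∃ v : HeightOneSpectrum (𝓞 ℚ), (primesEquiv v : ℕ) = 3 :=
    ⟨primesEquiv.symm ⟨3, Nat.prime_three⟩, by rw [Equiv.apply_symm_apply]⟩
  obtain ⟨𝔓, hmem, h𝔓⟩ := exists_ideal_placeOver 3 hv
  exact towerSurj_three_of_surj_of_nine_dvd_relIndex_stabilizer W hsurj _ hC9 hCsmul
    (nine_dvd_relIndex_stabilizer_inertia_of_valuation W hv hmem h𝔓 C hzL hz0 hfix hval hcop h9) n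

/-- **Kato's (12.5.2) at `3`** from surj(3) and one `Stab(C)`-invariant of valuation with
`9`-divisible denominator. [cite: Kato2004Asterisque, (12.5.2) (p. 222)] [cite: SerreAbelianLadic1968, Ch. IV §3.4, Lemma 3 (IV-23)] -/
theorem imageContainsSL2_three_of_surj_of_valuation_of_stabilizer
    (hsurj : W.HasSurjectiveModNGaloisRep 3)
    {C : Set W.geomPoints} (hC9 : C ⊆ (geomTorsion W 9 : Set W.geomPoints))
    (hCsmul : ∀ m : ℕ, ∀ Q ∈ C, (1 + 3 * m) • Q ∈ C)
    {z : AlgebraicClosure ℚ} (hzL : z ∈ W.divisionField 9) (hz0 : z ≠ 0)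
    (hfix : ∀ σ ∈ MulAction.stabilizer (absoluteGaloisGroup ℚ) C, σ • z = z) {d a b : ℕ}
    (hval : (placeOver 3).valuation z ^ d * (placeOver 3).valuation 3 ^ a =
      (placeOver 3).valuation 3 ^ b)
    (hcop : IsCoprime (d : ℤ) ((a : ℤ) - b)) (h9 : 9 ∣ d) : Kato2004.ImageContainsSL2 W 3 := by
  haveI : Fact (Nat.Prime 3) := ⟨Nat.prime_three⟩
  exact (Kato2004.imageContainsSL2_iff_forall_hasSurjectiveModNGaloisRep W 3).mpr
    (towerSurj_three_of_surj_of_valuation_of_stabilizer W hsurj hC9 hCsmul hzL hz0 hfix hval hcop h9)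

/-- **CYCLIC FORM.**  `ρ̄_{E,3}` onto, `Q₀ ∈ E[9]`, `z ∈ ℚ(E[9])` non-zero and fixed by every
`σ ∈ Γ_ℚ` with `σ Q₀ ∈ ℤ·Q₀` (an invariant of the cyclic subgroup `ℤ·Q₀`), and
`v(z)^d · v(3)^a = v(3)^b` with `d` coprime to `a − b`, `9 ∣ d` ⟹ `ρ̄_{E,3ⁿ}` onto for all `n`.
[cite: SerreAbelianLadic1968, Ch. IV §3.4, Lemma 3 (IV-23)] [cite: SerreLocalFields1979, Ch. I §7 Prop. 22] -/
theorem towerSurj_three_of_surj_of_valuation_of_smul_zmultiples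
    (hsurj : W.HasSurjectiveModNGaloisRep 3) {Q₀ : W.geomPoints} (hQ₀ : Q₀ ∈ geomTorsion W 9)
    {z : AlgebraicClosure ℚ} (hzL : z ∈ W.divisionField 9) (hz0 : z ≠ 0)
    (hfix : ∀ σ : absoluteGaloisGroup ℚ, (∃ k : ℤ, σ • Q₀ = k • Q₀) → σ • z = z) {d a b : ℕ}
    (hval : (placeOver 3).valuation z ^ d * (placeOver 3).valuation 3 ^ a =
      (placeOver 3).valuation 3 ^ b)
    (hcop : IsCoprime (d : ℤ) ((a : ℤ) - b)) (h9 : 9 ∣ d) (n : ℕ) :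
    W.HasSurjectiveModNGaloisRep (3 ^ n : ℕ) :=
  towerSurj_three_of_surj_of_valuation_of_stabilizer W hsurj (zmultiples_subset_geomTorsion_nine W hQ₀)
    (nsmul_mem_zmultiples_of_mem W Q₀) hzL hz0
    (fun σ hσ ↦ hfix σ (smul_mem_zmultiples_of_mem_stabilizer W hσ)) hval hcop h9 n

/-- **On an EXOTIC row no stabiliser-invariant has a `9`-divisible denominator.**  If `ρ̄_{E,3}`
is onto and the `3`-adic tower fails at some level, then for every scalar-closed `C ⊆ E[9]` and every
non-zero `Stab(C)`-invariant `z ∈ ℚ(E[9])`, an identity `v(z)^d · v(3)^a = v(3)^b` with `d` coprime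
to `a − b` forces `9 ∤ d` (every `ℚ₃(C)` has ramification index prime to `9`: the sharp local
signature of the Elkies rows). [cite: Elkies2006, §1] -/
theorem not_nine_dvd_of_valuation_of_not_towerSurj
    (hsurj : W.HasSurjectiveModNGaloisRep 3)
    (hnot : ¬ ∀ n : ℕ, W.HasSurjectiveModNGaloisRep (3 ^ n : ℕ))
    {C : Set W.geomPoints} (hC9 : C ⊆ (geomTorsion W 9 : Set W.geomPoints))
    (hCsmul : ∀ m : ℕ, ∀ Q ∈ C, (1 + 3 * m) • Q ∈ C)
    {z : AlgebraicClosure ℚ} (hzL : z ∈ W.divisionField 9) (hz0 : z ≠ 0)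
    (hfix : ∀ σ ∈ MulAction.stabilizer (absoluteGaloisGroup ℚ) C, σ • z = z) {d a b : ℕ}
    (hval : (placeOver 3).valuation z ^ d * (placeOver 3).valuation 3 ^ a =
      (placeOver 3).valuation 3 ^ b)
    (hcop : IsCoprime (d : ℤ) ((a : ℤ) - b)) : ¬ 9 ∣ d := fun h9 ↦
  hnot (towerSurj_three_of_surj_of_valuation_of_stabilizer W hsurj hC9 hCsmul hzL hz0 hfix hval hcop
    h9)

end Summit.BirchSwinnertonDyer.Rank1Residual.GaloisImage

end
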